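import Mathlib
import Summits.ValiantsHypothesis.ValiantsHypothesis.Theorems.BarrierLeverPartitionMinorsHitByVPHiddenStatesFullJoinDoor

/-!
# Route BarrierLever — item `PartitionMinorsHitByVP` (stmt-ValiantsHypothesis-19717), line `hidden_states`:
# THE STAR LEAF OF THE FULL JOIN — every layout of size `r ≤ K + 1` has a nonsingular one-cube full hidden sum

Helper file (`--supports stmt-ValiantsHypothesis-19717`; cell valiant-natproofs, rung V4, 𝒟-side door (c), line
`Cruxes/PartitionMinorsHitByVP/Lines/hidden_states.lean` v8; prover seat val-np-p3 gen 16). Definition-free. Closes NO item.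

THE POINT (memo val-np-p3 g16 «full join» §3, §8(b)). The LEAF of the PEEL⁺ scheme: for EVERY pair of injective families `u, w` of
`r ≤ K + 1` subsets of `Fin h` (no lower-set hypothesis) the one-cube full hidden sum with `K` states is nonsingular for some table
(`fullJoinCube_of_le`). Mechanism = the extremal term of the sub-star: the threshold family `S = {∅, {0}, …, {r−2}}` (weights `1` on the
first `r − 1` states, `2` on the others) is legal, and with the 0/1 table whose points are the incidence vectors `1_{u k}` the design minor
is the inclusion matrix `[u i ⊆ u k]`, which is invertible for every injective family (a supported row of minimal cardinality is alone in
its own column: `inclusionMatrix_isUnit`); likewise on the `w` side; then p672458 `fullJoin_det_ne_zero_of_threshold` converts the two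
design minors into a nonsingular FULL sum. Together with the equal-link step (p675243/p675575 `fullJoinCube_step'`) and the diagonal /
isomorphic base (p673836/p674147) this is the complete kernel toolkit for proving conjecture FJ on equal-link-peelable pairs.

WHAT THIS IS NOT: layouts with `r > K + 1` are not touched; item 19717 stays OPEN; nothing on crux 14610 or VP ≠ VNP.
-/

set_option linter.dupNamespace false

namespace Summit.ValiantsHypothesis.ValiantsHypothesis.Theorems.BarrierLever.HiddenStates

open Finset Matrix

noncomputable section

namespace FullJoin

variable {h r : ℕ}

/-- **The square inclusion matrix `[u i ⊆ u k]` of an injective family is invertible**: `v ↦ v ᵥ* P` is injective (a supported index of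
minimal cardinality is the only supported row that is `1` at its own column), hence `P` is a unit. -/
theorem inclusionMatrix_isUnit (u : Fin r → Finset (Fin h)) (hu : Function.Injective u) :
    IsUnit (Matrix.of fun i k : Fin r => if u i ⊆ u k then (1 : ℂ) else 0) := by
  classical
  set P : Matrix (Fin r) (Fin r) ℂ := Matrix.of fun i k => if u i ⊆ u k then (1 : ℂ) else 0 with hP
  rw [← Matrix.vecMul_injective_iff_isUnit]
  suffices hker : ∀ v : Fin r → ℂ, v ᵥ* P = 0 → v = 0 by
    intro v v' hvv'
    have hvv'' : v ᵥ* P = v' ᵥ* P := hvv'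
    have h0 : (v - v') ᵥ* P = 0 := by rw [Matrix.sub_vecMul, hvv'', sub_self]
    exact sub_eq_zero.mp (hker _ h0)
  intro v hv
  by_contra hne
  have hsupp : (Finset.univ.filter fun i : Fin r => v i ≠ 0).Nonempty := by
    by_contra hempty
    rw [Finset.not_nonempty_iff_eq_empty, Finset.filter_eq_empty_iff] at hempty
    exact hne (funext fun i => by simpa using hempty (Finset.mem_univ i))
  obtain ⟨i₀, hi₀, hmin⟩ := Finset.exists_min_image _ (fun i => (u i).card) hsupp
  have hvi₀ : v i₀ ≠ 0 := (Finset.mem_filter.mp hi₀).2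
  have hcol : (v ᵥ* P) i₀ = v i₀ := by
    rw [Matrix.vecMul, dotProduct, Finset.sum_eq_single i₀]
    · simp [hP]
    · intro i _ hi
      by_cases hvi : v i = 0
      · rw [hvi, zero_mul]
      · have hsub : ¬ u i ⊆ u i₀ := by
          intro hsub
          have hss : u i ⊂ u i₀ := lt_of_le_of_ne hsub (fun heq => hi (hu heq))
          exact absurd (hmin i (Finset.mem_filter.mpr ⟨Finset.mem_univ _, hvi⟩)) (not_le.mpr (Finset.card_lt_card hss))
        simp [hP, hsub]
    · intro h'; exact absurd (Finset.mem_univ i₀) h'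
  rw [hv] at hcol
  exact hvi₀ (by simpa using hcol.symm)

variable {K : ℕ}

/-- The sub-star column family: row index `0 ↦ ∅`, `i ↦ {i − 1}`; it needs `r ≤ K + 1`. -/
theorem subStar_injective (hr : r ≤ K + 1) :
    Function.Injective (fun i : Fin r => ((0 : Fin 1),
      (if h0 : (i : ℕ) = 0 then (∅ : Finset (Fin K)) else {⟨(i : ℕ) - 1, by omega⟩}))) := by
  intro i j hij
  simp only [Prod.mk.injEq, true_and] at hij
  by_cases hi : (i : ℕ) = 0 <;> by_cases hj : (j : ℕ) = 0
  · exact Fin.ext (by omega)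
  · rw [dif_pos hi, dif_neg hj] at hij
    exact absurd hij.symm (Finset.singleton_ne_empty _)
  · rw [dif_neg hi, dif_pos hj] at hij
    exact absurd hij (Finset.singleton_ne_empty _)
  · rw [dif_neg hi, dif_neg hj, Finset.singleton_inj] at hij
    have := congrArg Fin.val hij
    simp only at this
    exact Fin.ext (by omega)

/-- **The design minor of the sub-star with the incidence table is the inclusion matrix.** With `tx none a = [a ∈ u 0']` (the row sent to
`∅`) and `tx (some q) a = [a ∈ u (q+1)'] − [a ∈ u 0']` for `q < r − 1`, the point of the column `J_k` is the incidence vector of `u k`, so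
`∏_{a ∈ u i} (point_k)_a = [u i ⊆ u k]`. -/
theorem subStar_minor_eq (hr : r ≤ K + 1) (u : Fin r → Finset (Fin h)) (i k : Fin r) :
    (∏ a ∈ u i, ((fun (o : Option (Fin K)) (a : Fin h) => (o.elim
        (if hr0 : 0 < r then (if a ∈ u ⟨0, hr0⟩ then (1 : ℂ) else 0) else 0)
        (fun q => if hq : (q : ℕ) + 1 < r then
          ((if a ∈ u ⟨(q : ℕ) + 1, hq⟩ then (1 : ℂ) else 0) -
            (if hr0 : 0 < r then (if a ∈ u ⟨0, hr0⟩ then (1 : ℂ) else 0) else 0))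
          else 0) : ℂ)) none a +
        ∑ q ∈ (if h0 : (k : ℕ) = 0 then (∅ : Finset (Fin K)) else {⟨(k : ℕ) - 1, by omega⟩}),
          (fun (o : Option (Fin K)) (a : Fin h) => (o.elim
            (if hr0 : 0 < r then (if a ∈ u ⟨0, hr0⟩ then (1 : ℂ) else 0) else 0)
            (fun q => if hq : (q : ℕ) + 1 < r then
              ((if a ∈ u ⟨(q : ℕ) + 1, hq⟩ then (1 : ℂ) else 0) -
                (if hr0 : 0 < r then (if a ∈ u ⟨0, hr0⟩ then (1 : ℂ) else 0) else 0))
              else 0) : ℂ)) (some q) a)) =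
      if u i ⊆ u k then (1 : ℂ) else 0 := by
  classical
  have hr0 : 0 < r := Fin.pos k
  -- every factor is the indicator `[a ∈ u k]`
  have hfac : ∀ a : Fin h, ((fun (o : Option (Fin K)) (a : Fin h) => (o.elim
        (if hr0 : 0 < r then (if a ∈ u ⟨0, hr0⟩ then (1 : ℂ) else 0) else 0)
        (fun q => if hq : (q : ℕ) + 1 < r then
          ((if a ∈ u ⟨(q : ℕ) + 1, hq⟩ then (1 : ℂ) else 0) -
            (if hr0 : 0 < r then (if a ∈ u ⟨0, hr0⟩ then (1 : ℂ) else 0) else 0))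
          else 0) : ℂ)) none a +
        ∑ q ∈ (if h0 : (k : ℕ) = 0 then (∅ : Finset (Fin K)) else {⟨(k : ℕ) - 1, by omega⟩}),
          (fun (o : Option (Fin K)) (a : Fin h) => (o.elim
            (if hr0 : 0 < r then (if a ∈ u ⟨0, hr0⟩ then (1 : ℂ) else 0) else 0)
            (fun q => if hq : (q : ℕ) + 1 < r then
              ((if a ∈ u ⟨(q : ℕ) + 1, hq⟩ then (1 : ℂ) else 0) -
                (if hr0 : 0 < r then (if a ∈ u ⟨0, hr0⟩ then (1 : ℂ) else 0) else 0))
              else 0) : ℂ)) (some q) a) =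
      if a ∈ u k then (1 : ℂ) else 0 := by
    intro a
    by_cases hk0 : (k : ℕ) = 0
    · rw [dif_pos hk0, Finset.sum_empty, add_zero]
      have hk : k = ⟨0, hr0⟩ := Fin.ext hk0
      subst hk
      simp only [Option.elim, dif_pos hr0]
    · have hk1 : (k : ℕ) - 1 + 1 < r := by omega
      have hk : (⟨(k : ℕ) - 1 + 1, hk1⟩ : Fin r) = k := Fin.ext (by simp only; omega)
      simp only [Option.elim, dif_pos hr0, dif_neg hk0, Finset.sum_singleton, dif_pos hk1, hk]
      ring
  simp_rw [hfac]
  rw [Finset.prod_boole]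
  rfl

/-- **THE STAR LEAF.** Every pair of injective families of `r ≤ K + 1` subsets of `Fin h` has a nonsingular one-cube full hidden sum with `K`
states (no lower-set hypothesis). -/
theorem fullJoinCube_of_le (u w : Fin r → Finset (Fin h)) (hu : Function.Injective u) (hw : Function.Injective w)
    (hr : r ≤ K + 1) :
    ∃ (tx ty : Option (Fin K) → Fin h → ℂ) (lam : Fin K → ℂ),
      (Matrix.of fun i j : Fin r => ∑ J : Finset (Fin K), (∏ q ∈ J, lam q) *
        ((∏ a ∈ u i, (tx none a + ∑ q ∈ J, tx (some q) a)) *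
          ∏ c ∈ w j, (ty none c + ∑ q ∈ J, ty (some q) c))).det ≠ 0 := by
  classical
  -- the sub-star design (one piece)
  let e : Fin r → Fin 1 × Finset (Fin K) := fun i => ((0 : Fin 1),
    (if h0 : (i : ℕ) = 0 then (∅ : Finset (Fin K)) else {⟨(i : ℕ) - 1, by omega⟩}))
  have he : Function.Injective e := subStar_injective hr
  let W : Fin 1 → ℕ := fun _ => 0
  let wt : Fin 1 → Fin K → ℕ := fun _ q => if (q : ℕ) + 1 < r then 1 else 2
  -- legality: members weigh ≤ 1, non-members ≥ 2
  have hmem_le : ∀ i, W (e i).1 + ∑ q ∈ (e i).2, wt (e i).1 q ≤ 1 := by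
    intro i
    by_cases hi : (i : ℕ) = 0
    · simp [e, W, hi]
    · have : ((⟨(i : ℕ) - 1, by omega⟩ : Fin K) : ℕ) + 1 < r := by simp only; omega
      simp [e, W, wt, hi, this]
  have hthr : ∀ x : Fin 1 × Finset (Fin K), x ∉ Set.range e →
      ∀ i, W (e i).1 + ∑ q ∈ (e i).2, wt (e i).1 q < W x.1 + ∑ q ∈ x.2, wt x.1 q := by
    intro x hx i
    have hr0 : 0 < r := Fin.pos i
    refine lt_of_le_of_lt (hmem_le i) ?_
    -- a non-member has weight ≥ 2
    have h2 : 2 ≤ W x.1 + ∑ q ∈ x.2, wt x.1 q := by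
      by_contra hlt
      rw [not_le] at hlt
      apply hx
      -- weight ≤ 1: `x.2` is empty or a single light state
      have hwt1 : ∀ q ∈ x.2, 1 ≤ wt x.1 q := fun q _ => by simp only [wt]; split_ifs <;> omega
      have hcard : x.2.card ≤ 1 := by
        have : x.2.card ≤ ∑ q ∈ x.2, wt x.1 q := by
          rw [Finset.card_eq_sum_ones]; exact Finset.sum_le_sum hwt1
        simp only [W, zero_add] at hlt
        omega
      rcases (Nat.le_one_iff_eq_zero_or_eq_one.mp hcard) with hzero | hone
      · -- `x = (0, ∅) = e 0`
        have hx2 : x.2 = ∅ := Finset.card_eq_zero.mp hzero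
        refine ⟨⟨0, hr0⟩, ?_⟩
        refine Prod.ext (Subsingleton.elim _ _) ?_
        simp [e, hx2]
      · obtain ⟨q, hx2⟩ := Finset.card_eq_one.mp hone
        have hq1 : (q : ℕ) + 1 < r := by
          simp only [W, zero_add, hx2, Finset.sum_singleton, wt] at hlt
          split_ifs at hlt with hq1
          · exact hq1
          · omega
        refine ⟨⟨(q : ℕ) + 1, hq1⟩, Prod.ext (Subsingleton.elim _ _) ?_⟩
        have hne : ((⟨(q : ℕ) + 1, hq1⟩ : Fin r) : ℕ) ≠ 0 := by simp
        simp only [e, dif_neg hne, hx2, Finset.singleton_inj]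
        exact Fin.ext (by simp)
    omega
  -- the incidence tables
  let tx : Fin 1 → Option (Fin K) → Fin h → ℂ := fun _ o a => (o.elim
    (if hr0 : 0 < r then (if a ∈ u ⟨0, hr0⟩ then (1 : ℂ) else 0) else 0)
    (fun q => if hq : (q : ℕ) + 1 < r then
      ((if a ∈ u ⟨(q : ℕ) + 1, hq⟩ then (1 : ℂ) else 0) - (if hr0 : 0 < r then (if a ∈ u ⟨0, hr0⟩ then (1 : ℂ) else 0) else 0))
      else 0) : ℂ)
  let ty : Fin 1 → Option (Fin K) → Fin h → ℂ := fun _ o c => (o.elim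
    (if hr0 : 0 < r then (if c ∈ w ⟨0, hr0⟩ then (1 : ℂ) else 0) else 0)
    (fun q => if hq : (q : ℕ) + 1 < r then
      ((if c ∈ w ⟨(q : ℕ) + 1, hq⟩ then (1 : ℂ) else 0) - (if hr0 : 0 < r then (if c ∈ w ⟨0, hr0⟩ then (1 : ℂ) else 0) else 0))
      else 0) : ℂ)
  have hx : (Matrix.of fun i k : Fin r =>
      ∏ a ∈ u i, (tx (e k).1 none a + ∑ q ∈ (e k).2, tx (e k).1 (some q) a)).det ≠ 0 := by
    have hmat : (Matrix.of fun i k : Fin r =>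
        ∏ a ∈ u i, (tx (e k).1 none a + ∑ q ∈ (e k).2, tx (e k).1 (some q) a)) =
        Matrix.of fun i k : Fin r => if u i ⊆ u k then (1 : ℂ) else 0 := by
      refine Matrix.ext fun i k => ?_
      rw [Matrix.of_apply, Matrix.of_apply]
      exact subStar_minor_eq hr u i k
    rw [hmat]
    exact ((Matrix.isUnit_iff_isUnit_det _).mp (inclusionMatrix_isUnit u hu)).ne_zero
  have hy : (Matrix.of fun j k : Fin r =>
      ∏ c ∈ w j, (ty (e k).1 none c + ∑ q ∈ (e k).2, ty (e k).1 (some q) c)).det ≠ 0 := by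
    have hmat : (Matrix.of fun j k : Fin r =>
        ∏ c ∈ w j, (ty (e k).1 none c + ∑ q ∈ (e k).2, ty (e k).1 (some q) c)) =
        Matrix.of fun j k : Fin r => if w j ⊆ w k then (1 : ℂ) else 0 := by
      refine Matrix.ext fun j k => ?_
      rw [Matrix.of_apply, Matrix.of_apply]
      exact subStar_minor_eq hr w j k
    rw [hmat]
    exact ((Matrix.isUnit_iff_isUnit_det _).mp (inclusionMatrix_isUnit w hw)).ne_zero
  obtain ⟨t₀, ht₀⟩ := fullJoin_det_ne_zero_of_threshold h 1 K r u w e he W wt hthr tx ty hx hy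
  refine ⟨tx 0, ty 0, fun q => t₀ ^ wt 0 q, ?_⟩
  have hmat : (Matrix.of fun i j : Fin r => ∑ p : Fin 1, ∑ J : Finset (Fin K),
      t₀ ^ W p * (∏ k ∈ J, t₀ ^ wt p k) *
        ((∏ a ∈ u i, (tx p none a + ∑ q ∈ J, tx p (some q) a)) *
          ∏ c ∈ w j, (ty p none c + ∑ q ∈ J, ty p (some q) c))) =
      Matrix.of fun i j : Fin r => ∑ J : Finset (Fin K), (∏ q ∈ J, (fun q => t₀ ^ wt 0 q) q) *
        ((∏ a ∈ u i, (tx 0 none a + ∑ q ∈ J, tx 0 (some q) a)) *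
          ∏ c ∈ w j, (ty 0 none c + ∑ q ∈ J, ty 0 (some q) c)) := by
    refine Matrix.ext fun i j => ?_
    simp only [Matrix.of_apply, Fin.sum_univ_one, W, pow_zero, one_mul]
  rw [← hmat]
  exact ht₀

end FullJoin

end

end Summit.ValiantsHypothesis.ValiantsHypothesis.Theorems.BarrierLever.HiddenStates
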